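import Summits.BirchSwinnertonDyer.BirchSwinnertonDyer.Theorems.ErratumRoadFiveNonSurjCornerLocalFrame
import HarnessLib

/-!
# Route `ErratumRoadFive` (rung K2), crux `NonSurjCorner` (item stmt-BirchSwinnertonDyer-19065):
# LOCAL SPLITTING AT `p` ON THE WHOLE CORNER, frame-free — two cyclic subgroups `L₀, L₁ ≤ E[p]` of
# order `p`, `L₀ ⊓ L₁ = 0`, both stable under the decomposition group at `p`, `E[p]^{I_p} = L₀`
# (cell `bsd-stepL`, seat `bsd-stepL-corner5-p2` g3, WIDTH-LEVER lane B «class-level road»;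
# `--supports stmt-BirchSwinnertonDyer-19065 --as helper`; file 2 of 2, after `…LocalFrame`)

WHY THIS FILE. `ErratumRoadFiveNonSurjCornerLocalFrame.lean` (this seat) proved, for `W/ℚ` elliptic,
`p ≠ 2` multiplicative with `p ∤ #ρ̄_{E,p}(Γ_ℚ)` and a frame `(Φ, e)` of `E[p]`: some `P ∈ GL₂(𝔽_p)`
has `Φ(ρ̄(I_𝔏)) = P (1 0; 0 *) P⁻¹`, `Φ(ρ̄(D_𝔏)) ≤ P (* 0; 0 *) P⁻¹`, and `E[p]^{I_𝔏} = e⁻¹(𝔽_p · P e₀)`.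
Here:

* §2c the lines `e⁻¹(𝔽_p · P eᵢ)` as the cyclic subgroups `ℤ · e⁻¹(P eᵢ)` of `E[p]`: membership,
  order `p`, trivial intersection;
* §3 `exists_inertiaFrame_local`: the frame read on the local Galois group `Γ_{ℚ_p}` through the
  restriction `res_ι` along a `ℚ`-embedding `ι : ℚ̄ → ℚ̄_p` (every `σ ∈ Γ_{ℚ_p}` acts diagonally) —
  the currency of the tree's Tate-curve files (`TateCurve/InertiaTorsionOfTateParameterPower`, …);
* §4 FRAME-FREE packaging: `exists_stable_lines_of_mult_of_not_dvd_card` and, at the crux hypotheses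
  (`ClassX11b W p`, `¬ Surj W p`, ANY `p`; `p ∤ #G` by Serre Prop. 15), **`NonSurjCorner.localSplit`**
  (decomposition group `D_𝔏 ≤ Γ_ℚ`) and **`NonSurjCorner.localSplit_local`** (`Γ_{ℚ_p}` via `res_ι`,
  `L₀` fixed by the local inertia group): `E[p]|_{Γ_{ℚ_p}} = L₀ ⊕ L₁ ≅ δ₁ ⊕ δ₂`, `δ₁` unramified.

This holds on the WHOLE corner — `5S4` (52 of the 64 census class-pairs), `5Ns` (12), `N_s(7)` — with
none of the crux binders `p ∈ {5,7}`, `p ∣ ord_p Δ_min`, `¬ Ram`. Consequence to be drawn in the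
sequel (`…TateParameter`): two `Γ_{ℚ_p}`-stable lines force the Tate parameter to be a `p`-th power in
`ℚ_p` ([GenEll] Lemma 3.2 (i), tree `TateCurve/RankOneTorsionSubgroups`). HONEST FRAMING: structure
theorems about the local Galois module at a corner pair; nothing here proves the crux, a registered
stub (`stub_corner5`, `stub_corner7`) or BSD for any class; no census number moves.

References: [Serre1972] §1.11–§1.12, §2.1 a), §2.4 Prop. 15; [SilvermanATAEC1994] V.4–V.6;
[NeukirchANT1999] II (9.6); tree files `Theorems/ErratumRoadFiveNonSurjCornerLocalFrame`,
`Theorems/ErratumRoadFiveNonSurjCornerShape`, `NeronOggShafarevichLocal`.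
-/

set_option linter.dupNamespace false -- `Summit.BirchSwinnertonDyer.BirchSwinnertonDyer` (summit = problem), tree-wide
set_option autoImplicit false

noncomputable section

open scoped Classical NumberField Pointwise
open IsDedekindDomain Field Matrix

namespace Summit.BirchSwinnertonDyer.BirchSwinnertonDyer.Theorems.CornerLocal

open WeierstrassCurve NumberField Rat.HeightOneSpectrum
  Literature.NumberTheory.EllipticCurves Literature.NumberTheory.GaloisRepresentations
  Literature.NumberTheory.GaloisRepresentations.Serre1972
  Literature.NumberTheory.EllipticCurves.Rank1Residual
  Summit.BirchSwinnertonDyer.Rank1Residual Summit.BirchSwinnertonDyer.Rank1Residual.GaloisImage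
  Summit.BirchSwinnertonDyer.BirchSwinnertonDyer.Theorems.CornerShape

variable (W : WeierstrassCurve ℚ) [W.IsElliptic] (p : ℕ) [hp : Fact p.Prime]

section Frame

variable (Φ : Multiplicative (AddAut (geomTorsion W p)) ≃* GL (Fin 2) (ZMod p))
  (e : geomTorsion W p ≃+ (Fin 2 → ZMod p))
  (he : ∀ (g : Multiplicative (AddAut (geomTorsion W p))) (x : geomTorsion W p),
    e (Multiplicative.toAdd g x) =
      ((Φ g : GL (Fin 2) (ZMod p)) : Matrix (Fin 2) (Fin 2) (ZMod p)) *ᵥ e x)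

include he

/-! ### §2c. Lines of the frame as cyclic subgroups of `E[p]` -/

omit [W.IsElliptic] he in
/-- Membership in the line `e⁻¹(𝔽_p · w)`, written as the cyclic subgroup generated by `e⁻¹(w)`:
`x ∈ ℤ · e⁻¹(w) ↔ e x ∈ 𝔽_p · w`. [folklore] -/
theorem mem_zmultiples_symm_iff (w : Fin 2 → ZMod p) (x : geomTorsion W p) :
    x ∈ AddSubgroup.zmultiples (e.symm w) ↔ ∃ a : ZMod p, e x = a • w := by
  constructor
  · rintro ⟨n, rfl⟩
    refine ⟨(n : ZMod p), ?_⟩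
    rw [map_zsmul, AddEquiv.apply_symm_apply, Int.cast_smul_eq_zsmul]
  · rintro ⟨a, ha⟩
    refine ⟨(a.val : ℤ), e.injective ?_⟩
    rw [map_zsmul, AddEquiv.apply_symm_apply, ha, ← ZMod.natCast_zmod_val a, natCast_zsmul,
      Nat.cast_smul_eq_nsmul]
    simp

omit [W.IsElliptic] he in
/-- The line `e⁻¹(𝔽_p · P eᵢ)` of `E[p]` has exactly `p` elements (`P eᵢ ≠ 0`, `p · E[p] = 0`).
[folklore] -/
theorem card_zmultiples_symm_col (P : GL (Fin 2) (ZMod p)) (i : Fin 2) :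
    Nat.card (AddSubgroup.zmultiples
      (e.symm ((P : Matrix (Fin 2) (Fin 2) (ZMod p)).col i))) = p := by
  have hpp : p.Prime := hp.out
  rw [Nat.card_zmultiples]
  apply addOrderOf_eq_prime
  · apply e.injective
    rw [map_nsmul, AddEquiv.apply_symm_apply, map_zero, ← Nat.cast_smul_eq_nsmul (ZMod p),
      ZMod.natCast_self, zero_smul]
  · intro h0
    have hcol : (P : Matrix (Fin 2) (Fin 2) (ZMod p)).col i = 0 := by
      rw [← e.apply_symm_apply ((P : Matrix (Fin 2) (Fin 2) (ZMod p)).col i), h0, map_zero]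
    apply GL2.det_ne_zero P
    rw [Matrix.det_fin_two]
    have h0i : (P : Matrix (Fin 2) (Fin 2) (ZMod p)) 0 i = 0 := by
      simpa using congrFun hcol 0
    have h1i : (P : Matrix (Fin 2) (Fin 2) (ZMod p)) 1 i = 0 := by
      simpa using congrFun hcol 1
    fin_cases i
    · simp only [Fin.zero_eta] at h0i h1i
      rw [h0i, h1i, zero_mul, mul_zero, sub_zero]
    · simp only [Fin.mk_one] at h0i h1i
      rw [h0i, h1i, zero_mul, mul_zero, sub_zero]

omit [W.IsElliptic] he in
/-- The two lines `e⁻¹(𝔽_p · P e₀)`, `e⁻¹(𝔽_p · P e₁)` of `E[p]` meet in `0`. [folklore] -/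
theorem zmultiples_symm_col_inf_eq_bot (P : GL (Fin 2) (ZMod p)) :
    AddSubgroup.zmultiples (e.symm ((P : Matrix (Fin 2) (Fin 2) (ZMod p)).col 0)) ⊓
      AddSubgroup.zmultiples (e.symm ((P : Matrix (Fin 2) (Fin 2) (ZMod p)).col 1)) = ⊥ := by
  rw [eq_bot_iff]
  rintro x ⟨h0, h1⟩
  obtain ⟨a, ha⟩ := (mem_zmultiples_symm_iff W p e _ x).mp h0
  obtain ⟨b, hb⟩ := (mem_zmultiples_symm_iff W p e _ x).mp h1
  rw [AddSubgroup.mem_bot]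
  -- `P⁻¹ (e x) = (a, 0) = (0, b)`
  have key : ∀ (c : ZMod p) (i : Fin 2),
      ((P⁻¹ : GL (Fin 2) (ZMod p)) : Matrix (Fin 2) (Fin 2) (ZMod p)) *ᵥ
        (c • (P : Matrix (Fin 2) (Fin 2) (ZMod p)).col i) = Pi.single i c := by
    intro c i
    have hcol : (P : Matrix (Fin 2) (Fin 2) (ZMod p)).col i =
        (P : Matrix (Fin 2) (Fin 2) (ZMod p)) *ᵥ Pi.single i 1 := by
      ext j
      fin_cases i <;> simp [Matrix.mulVec, dotProduct, Fin.sum_univ_two, Matrix.col_apply]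
    rw [Matrix.mulVec_smul, hcol, Matrix.mulVec_mulVec, ← Units.val_mul, inv_mul_cancel,
      Units.val_one, Matrix.one_mulVec, ← Pi.single_smul, smul_eq_mul, mul_one]
  have h := key a 0
  rw [← ha, hb, key b 1] at h
  have ha0 : a = 0 := by simpa using (congrFun h 0).symm
  apply e.injective
  rw [ha, ha0, zero_smul, map_zero]

/-! ### §3. Read on the local Galois group `Γ_{ℚ_p}` along an embedding `ℚ̄ → ℚ̄_p` -/

/-- **The inertia frame, local form.** Along a `ℚ`-embedding `ι : ℚ̄ → ℚ̄_p` with local prime `𝔐`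
and global prime `𝔏 = 𝔓_{ι,𝔐}` below it: some `P` has `Φ(ρ̄(I_𝔏)) = P (1 0; 0 *) P⁻¹` and EVERY
element of the local Galois group `Γ_{ℚ_p}` acts (through `res_ι`) inside `P (* 0; 0 *) P⁻¹` — the
local Galois module `E[p]|_{Γ_{ℚ_p}}` is the direct sum of two characters (hypotheses as in
`exists_inertiaFrame`). [cite: Serre1972, §1.12 and §2.1 a)] [cite: NeukirchANT1999, Ch. II §9 Prop. (9.6)] -/
theorem exists_inertiaFrame_local (hp2 : p ≠ 2) (hmult : Mult W p)
    (hG : ¬ p ∣ Nat.card ((galoisRepTorsion W p).range.map Φ.toMonoidHom))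
    {v : HeightOneSpectrum (𝓞 ℚ)} (hv : (primesEquiv v : ℕ) = p)
    (ι : AlgebraicClosure ℚ →ₐ[ℚ] AlgebraicClosure (v.adicCompletion ℚ))
    {𝔐 : Ideal (v.localAbsIntegers)} (h𝔐 : 𝔐 ∈ v.localPrimesAbove) :
    ∃ P : GL (Fin 2) (ZMod p),
      (((v.primeBelow ι 𝔐).inertia (absoluteGaloisGroup ℚ)).map (galoisRepTorsion W p)).map
          Φ.toMonoidHom = halfSplitCartan P ∧
      ∀ σ : absoluteGaloisGroup (v.adicCompletion ℚ),
        resGalOfEmb ι σ ∈ ((splitCartan P).comap Φ.toMonoidHom).comap (galoisRepTorsion W p) := by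
  obtain ⟨P, hP, hstab⟩ := exists_inertiaFrame_stabilizer W p Φ e he hp2 hmult hG hv
    (HeightOneSpectrum.primeBelow_mem_primesAbove (ι := ι) h𝔐)
  exact ⟨P, hP, fun σ ↦ hstab _ (HeightOneSpectrum.resGalOfEmb_mem_stabilizer_primeBelow v ι h𝔐 σ)⟩

end Frame

/-! ### §4. Frame-free packaging at the crux hypotheses -/

/-- **LOCAL SPLITTING AT `p` (frame-free), under `Mult ∧ p ∤ #ρ̄(Γ_ℚ)`, `p ≠ 2`.** For every prime
`𝔏 ∣ p` of `ℤ̄` there are two cyclic subgroups `L₀, L₁ ≤ E[p]` of order `p` with `L₀ ⊓ L₁ = 0`, BOTH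
stable under the decomposition group `D_𝔏 = Stab_{Γ_ℚ}(𝔏)`, such that the points of `E[p]` fixed by
the inertia group `I_𝔏` are EXACTLY `L₀`. (`Lᵢ = e⁻¹(𝔽_p · P eᵢ)` for the inertia frame `P` of §2.)
[cite: Serre1972, §1.12 and §2.1 a)] -/
theorem exists_stable_lines_of_mult_of_not_dvd_card (hp2 : p ≠ 2) (hmult : Mult W p)
    (hG : ¬ p ∣ Nat.card (galoisRepTorsion W p).range)
    {v : HeightOneSpectrum (𝓞 ℚ)} (hv : (primesEquiv v : ℕ) = p)
    {𝔏 : Ideal (absIntegers (𝓞 ℚ) ℚ)} (h𝔏 : 𝔏 ∈ v.primesAbove) :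
    ∃ L₀ L₁ : AddSubgroup (geomTorsion W p),
      Nat.card L₀ = p ∧ Nat.card L₁ = p ∧ L₀ ⊓ L₁ = ⊥ ∧
      (∀ g ∈ MulAction.stabilizer (absoluteGaloisGroup ℚ) 𝔏,
        (∀ x ∈ L₀, g • x ∈ L₀) ∧ (∀ x ∈ L₁, g • x ∈ L₁)) ∧
      ∀ x : geomTorsion W p, (∀ τ ∈ 𝔏.inertia (absoluteGaloisGroup ℚ), τ • x = x) ↔ x ∈ L₀ := by
  obtain ⟨e, Φ, he, -⟩ := exists_frame_galoisRepTorsion_rat W p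
  have hG' : ¬ p ∣ Nat.card ((galoisRepTorsion W p).range.map Φ.toMonoidHom) := by
    rwa [card_map_range_galoisRepTorsion W p Φ]
  obtain ⟨P, hP, hstab⟩ := exists_inertiaFrame_stabilizer W p Φ e he hp2 hmult hG' hv h𝔏
  refine ⟨AddSubgroup.zmultiples (e.symm ((P : Matrix (Fin 2) (Fin 2) (ZMod p)).col 0)),
    AddSubgroup.zmultiples (e.symm ((P : Matrix (Fin 2) (Fin 2) (ZMod p)).col 1)),
    card_zmultiples_symm_col W p e P 0, card_zmultiples_symm_col W p e P 1,
    zmultiples_symm_col_inf_eq_bot W p e P, fun g hg ↦ ⟨fun x hx ↦ ?_, fun x hx ↦ ?_⟩, fun x ↦ ?_⟩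
  · exact (mem_zmultiples_symm_iff W p e _ _).mpr
      (cartanSubgroup_stable_lines W p Φ e he (hstab g hg) 0 x
        ((mem_zmultiples_symm_iff W p e _ _).mp hx))
  · exact (mem_zmultiples_symm_iff W p e _ _).mpr
      (cartanSubgroup_stable_lines W p Φ e he (hstab g hg) 1 x
        ((mem_zmultiples_symm_iff W p e _ _).mp hx))
  · rw [forall_inertia_smul_eq_iff W p Φ e he hp2 hP x, mem_zmultiples_symm_iff W p e]

/-- **LOCAL SPLITTING AT `p` ON THE WHOLE CORNER** (crux `NonSurjCorner`, BOTH stubs, every `5S4`,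
`5Ns` and `N_s(7)` pair — and verbatim at any odd `p`): for `(E, p)` in class X11b with `ρ̄_{E,p}` NOT
onto and every prime `𝔏 ∣ p` of `ℤ̄`, `E[p]` contains two cyclic subgroups `L₀, L₁` of order `p`,
`L₀ ⊓ L₁ = 0`, both stable under the decomposition group `D_𝔏`, with `E[p]^{I_𝔏} = L₀`: as a
`D_𝔏`-module `E[p] = L₀ ⊕ L₁ ≅ δ₁ ⊕ δ₂` with `δ₁` UNRAMIFIED and `δ₂` ramified (`δ₁δ₂ = ω`). The crux
binders `p ∣ ord_p Δ_min`, `¬ Ram`, `p ∈ {5, 7}` are not used (`p ≠ 2` is inside `ClassX11b`; `p ∤ #G`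
from `Irr ∧ ¬Surj`, Serre Prop. 15). Nothing about BSD is claimed.
[cite: Serre1972, §1.12, §2.1 a), §2.4 Prop. 15] -/
theorem NonSurjCorner.localSplit [W.IsGloballyMinimal] (hX : ClassX11b W p) (hns : ¬ Surj W p)
    {v : HeightOneSpectrum (𝓞 ℚ)} (hv : (primesEquiv v : ℕ) = p)
    {𝔏 : Ideal (absIntegers (𝓞 ℚ) ℚ)} (h𝔏 : 𝔏 ∈ v.primesAbove) :
    ∃ L₀ L₁ : AddSubgroup (geomTorsion W p),
      Nat.card L₀ = p ∧ Nat.card L₁ = p ∧ L₀ ⊓ L₁ = ⊥ ∧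
      (∀ g ∈ MulAction.stabilizer (absoluteGaloisGroup ℚ) 𝔏,
        (∀ x ∈ L₀, g • x ∈ L₀) ∧ (∀ x ∈ L₁, g • x ∈ L₁)) ∧
      ∀ x : geomTorsion W p, (∀ τ ∈ 𝔏.inertia (absoluteGaloisGroup ℚ), τ • x = x) ↔ x ∈ L₀ := by
  obtain ⟨-, hp2, hmult, hirr⟩ := hX
  obtain ⟨e, Φ, he, -⟩ := exists_frame_galoisRepTorsion_rat W p
  have hG : ¬ p ∣ Nat.card (galoisRepTorsion W p).range := by
    rw [← card_map_range_galoisRepTorsion W p Φ]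
    exact not_dvd_card_of_not_hasSurjectiveModNGaloisRep W p Φ e he hirr hns
  exact exists_stable_lines_of_mult_of_not_dvd_card W p hp2 hmult hG hv h𝔏

/-- **LOCAL SPLITTING read on `Γ_{ℚ_p}`, under `Mult ∧ p ∤ #ρ̄(Γ_ℚ)`, `p ≠ 2`** (the currency of
the tree's Tate-curve files): along a `ℚ`-embedding `ι : ℚ̄ → ℚ̄_p` with local prime `𝔐`, there are
two cyclic subgroups `L₀, L₁ ≤ E[p](ℚ̄)` of order `p`, `L₀ ⊓ L₁ = 0`, each stable under EVERY
`σ ∈ Γ_{ℚ_p}` acting through `res_ι`, with `L₀` fixed pointwise by the local inertia group `I_𝔐`.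
[cite: Serre1972, §1.12 and §2.1 a)] [cite: NeukirchANT1999, Ch. II §9 Prop. (9.6)] -/
theorem exists_stable_lines_local_of_mult_of_not_dvd_card (hp2 : p ≠ 2) (hmult : Mult W p)
    (hG : ¬ p ∣ Nat.card (galoisRepTorsion W p).range)
    {v : HeightOneSpectrum (𝓞 ℚ)} (hv : (primesEquiv v : ℕ) = p)
    (ι : AlgebraicClosure ℚ →ₐ[ℚ] AlgebraicClosure (v.adicCompletion ℚ))
    {𝔐 : Ideal (v.localAbsIntegers)} (h𝔐 : 𝔐 ∈ v.localPrimesAbove) :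
    ∃ L₀ L₁ : AddSubgroup (geomTorsion W p),
      Nat.card L₀ = p ∧ Nat.card L₁ = p ∧ L₀ ⊓ L₁ = ⊥ ∧
      (∀ σ : absoluteGaloisGroup (v.adicCompletion ℚ),
        (∀ x ∈ L₀, resGalOfEmb ι σ • x ∈ L₀) ∧ (∀ x ∈ L₁, resGalOfEmb ι σ • x ∈ L₁)) ∧
      ∀ σ ∈ 𝔐.inertia (absoluteGaloisGroup (v.adicCompletion ℚ)), ∀ x ∈ L₀,
        resGalOfEmb ι σ • x = x := by
  obtain ⟨L₀, L₁, h₀, h₁, hinf, hstab, hfix⟩ :=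
    exists_stable_lines_of_mult_of_not_dvd_card W p hp2 hmult hG hv
      (HeightOneSpectrum.primeBelow_mem_primesAbove (ι := ι) h𝔐)
  refine ⟨L₀, L₁, h₀, h₁, hinf,
    fun σ ↦ hstab _ (HeightOneSpectrum.resGalOfEmb_mem_stabilizer_primeBelow v ι h𝔐 σ),
    fun σ hσ x hx ↦ ?_⟩
  exact (hfix x).mpr hx _ (HeightOneSpectrum.resGalOfEmb_mem_inertia_primeBelow v ι 𝔐 hσ)

/-- **LOCAL SPLITTING ON THE WHOLE CORNER, read on `Γ_{ℚ_p}`**: for `(E, p)` in class X11b with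
`ρ̄_{E,p}` NOT onto, a `ℚ`-embedding `ι : ℚ̄ → ℚ̄_p` and the local prime `𝔐`, there are two cyclic
subgroups `L₀, L₁ ≤ E[p](ℚ̄)` of order `p`, `L₀ ⊓ L₁ = 0`, each stable under EVERY `σ ∈ Γ_{ℚ_p}`
acting through `res_ι`, with `L₀` fixed pointwise by the local inertia group `I_𝔐`.
[cite: Serre1972, §1.12, §2.1 a), §2.4 Prop. 15] [cite: NeukirchANT1999, Ch. II §9 Prop. (9.6)] -/
theorem NonSurjCorner.localSplit_local [W.IsGloballyMinimal] (hX : ClassX11b W p) (hns : ¬ Surj W p)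
    {v : HeightOneSpectrum (𝓞 ℚ)} (hv : (primesEquiv v : ℕ) = p)
    (ι : AlgebraicClosure ℚ →ₐ[ℚ] AlgebraicClosure (v.adicCompletion ℚ))
    {𝔐 : Ideal (v.localAbsIntegers)} (h𝔐 : 𝔐 ∈ v.localPrimesAbove) :
    ∃ L₀ L₁ : AddSubgroup (geomTorsion W p),
      Nat.card L₀ = p ∧ Nat.card L₁ = p ∧ L₀ ⊓ L₁ = ⊥ ∧
      (∀ σ : absoluteGaloisGroup (v.adicCompletion ℚ),
        (∀ x ∈ L₀, resGalOfEmb ι σ • x ∈ L₀) ∧ (∀ x ∈ L₁, resGalOfEmb ι σ • x ∈ L₁)) ∧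
      ∀ σ ∈ 𝔐.inertia (absoluteGaloisGroup (v.adicCompletion ℚ)), ∀ x ∈ L₀,
        resGalOfEmb ι σ • x = x := by
  obtain ⟨-, hp2, hmult, hirr⟩ := hX
  obtain ⟨e, Φ, he, -⟩ := exists_frame_galoisRepTorsion_rat W p
  have hG : ¬ p ∣ Nat.card (galoisRepTorsion W p).range := by
    rw [← card_map_range_galoisRepTorsion W p Φ]
    exact not_dvd_card_of_not_hasSurjectiveModNGaloisRep W p Φ e he hirr hns
  exact exists_stable_lines_local_of_mult_of_not_dvd_card W p hp2 hmult hG hv ι h𝔐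

end Summit.BirchSwinnertonDyer.BirchSwinnertonDyer.Theorems.CornerLocal

end
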